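import Summits.NavierStokesRegularity.NavierStokesRegularity.Theorems.IsobarTomographyIsobaricLinesLiouvilleStubErtelIdentity
import Summits.NavierStokesRegularity.NavierStokesRegularity.Theorems.IsobarTomographyIsobaricLinesLiouvilleStubTwistIdentity
import Summits.NavierStokesRegularity.NavierStokesRegularity.Theorems.IsobarTomographyIsobaricLinesLiouvilleStubNewcombClosedLine
import Summits.NavierStokesRegularity.NavierStokesRegularity.Theorems.IsobarTomographyIsobaricLinesLiouvilleStubCovariance
import Summits.NavierStokesRegularity.NavierStokesRegularity.Theorems.IsobarTomographyIsobaricLinesLiouvilleStubFullTranslationLeaf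
import Summits.NavierStokesRegularity.NavierStokesRegularity.Theorems.IsobarTomographyIsobaricLinesLiouvilleIsometryTools
import Summits.NavierStokesRegularity.NavierStokesRegularity.Theorems.IsobarTomographyIsobaricLinesLiouvilleHullReductionLeaves
import Summits.NavierStokesRegularity.NavierStokesRegularity.Theses.IsobarTomography
import HarnessLib

/-!
# Hull reduction for the crux `IsobaricLinesLiouville` (stmt-NavierStokesRegularity-11741), line `Ideator2Sketch`

Lead file (supports the crux; continuation lead c1, re-landing the glue of the previous lead's
bounced p107740). Contents, all sorry-free over the landed stubs:

* `persistence_identity` — on the isobaric class `ω·∇q ≡ 0` the viscous Ertel law of the pressure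
  (`stub_ertelIdentity`) reads `ω·∇(Dₜq) = −Δω·∇q` (flux-surface persistence; Grad–Hogan's
  magnetic differential equation for the slip `Dₜq`);
* `twist_identity_isobaric` — `⟪ω,∂ₜv⟫ + ⟪ω,∇(‖v‖²/2)⟫ + ⟪ω, curl curl v⟫ = 0` on the class
  (`stub_twistIdentity` minus the pressure term);
* `sliceConst_of_translationInvariant` — Liouville for bounded ancient 2½-dimensional solutions
  invariant along an ARBITRARY direction `a ≠ 0` (Householder normalisation `exists_isometry_map_eq`,
  covariance `stub_covariance`, the `e₁`-leaf `stub_fullTranslationLeaf`);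
* `isobaricLinesLiouville_of_hull` / `hullRigidity_of_isobaricLinesLiouville` — the three-hull
  rigidity statement of the line (the registered stub `stub_hullRigidity`: (A) vorticity along one
  fixed vector ∨ (B) velocity invariant along one fixed direction ∨ (C) infinitesimal axisymmetry
  without swirl about one fixed axis, at all `t < 0`) IMPLIES the crux (composition with the landed
  leaves) and IS IMPLIED by it (constant slices have `ω ≡ 0`, hull (A) with `a = 0`). So the one
  open stub of the line is exactly crux-sized; this file records that equivalence in the tree.
Sources: Koch–Nadirashvili–Seregin–Šverák 2009 (arXiv:0709.3599) Thms 5.1–5.2; Ertel 1942;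
Grad–Hogan 1970; Newcomb 1959 (identity layer, see the imported stub files).
-/

noncomputable section

-- the summit and its single problem share the name (D-0017 nested layout)
set_option linter.dupNamespace false

namespace Summit.NavierStokesRegularity.NavierStokesRegularity.Theorems.IsobaricLinesLiouville.FluxSurfacePersistence

open scoped InnerProductSpace RealInnerProductSpace Topology ContDiff Laplacian
open Literature.Analysis.FluidPDE Set Filter MeasureTheory Function WithLp
open Summit.NavierStokesRegularity.NavierStokesRegularity.Theses.IsobarTomography

/-! ### Glue: persistence from Ertel, the 3-term twist -/

/-- **Flux-surface persistence** (first prolongation of isobaricity): on the isobaric class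
`Π₀ = ω·∇q ≡ 0` on `(-∞,0) × ℝ³`, so its time derivative within `(-∞,0)` and its spatial gradient
vanish and the viscous Ertel law (`stub_ertelIdentity`) reads `ω·∇(Dₜq) = -Δω·∇q`
(Grad–Hogan's magnetic differential equation for the slip `Dₜq`). -/
theorem persistence_identity (v : ℝ → (EuclideanSpace ℝ (Fin 3)) → (EuclideanSpace ℝ (Fin 3)))
    (q : ℝ → (EuclideanSpace ℝ (Fin 3)) → ℝ)
    (hcl : IsClassicalNSSolutionOn (Set.Iio 0) 1 0 v q)
    (hiso : ∀ t < 0, ∀ x : (EuclideanSpace ℝ (Fin 3)), ⟪curl (v t) x, gradient (q t) x⟫_ℝ = 0) :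
    ∀ t < 0, ∀ x : (EuclideanSpace ℝ (Fin 3)),
      ⟪curl (v t) x,
          gradient (fun y => timeDerivWithin (Set.Iio 0) q t y + ⟪v t y, gradient (q t) y⟫_ℝ) x⟫_ℝ
        = - ⟪(Δ (curl (v t))) x, gradient (q t) x⟫_ℝ := by
  intro t ht x
  have key := stub_ertelIdentity v q hcl t ht x
  have h1 : timeDerivWithin (Set.Iio 0) (fun s y => ⟪curl (v s) y, gradient (q s) y⟫_ℝ) t x = 0 := by
    rw [timeDerivWithin_apply]
    have : derivWithin (fun s => ⟪curl (v s) x, gradient (q s) x⟫_ℝ) (Set.Iio 0) t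
        = derivWithin (fun _ : ℝ => (0 : ℝ)) (Set.Iio 0) t := by
      apply derivWithin_congr
      · intro s hs
        exact hiso s hs x
      · exact hiso t ht x
    rw [this, derivWithin_fun_const]
    rfl
  have h2 : gradient (fun y => ⟪curl (v t) y, gradient (q t) y⟫_ℝ) x = 0 := by
    have : (fun y => ⟪curl (v t) y, gradient (q t) y⟫_ℝ) = fun _ => (0 : ℝ) := by
      funext y
      exact hiso t ht y
    rw [this]
    unfold gradient
    simp
  rw [h1, h2, inner_zero_right, zero_add] at key
  linarith

/-- **Twist identity on the isobaric class**: `⟪ω,∂ₜv⟫ + ⟪ω,∇(‖v‖²/2)⟫ + ⟪ω, curl curl v⟫ = 0`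
(`stub_twistIdentity` with the pressure term removed by `ω·∇q = 0`). -/
theorem twist_identity_isobaric (v : ℝ → (EuclideanSpace ℝ (Fin 3)) → (EuclideanSpace ℝ (Fin 3)))
    (q : ℝ → (EuclideanSpace ℝ (Fin 3)) → ℝ)
    (hcl : IsClassicalNSSolutionOn (Set.Iio 0) 1 0 v q)
    (hiso : ∀ t < 0, ∀ x : (EuclideanSpace ℝ (Fin 3)), ⟪curl (v t) x, gradient (q t) x⟫_ℝ = 0) :
    ∀ t < 0, ∀ x : (EuclideanSpace ℝ (Fin 3)),
      ⟪curl (v t) x, timeDerivWithin (Set.Iio 0) v t x⟫_ℝ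
        + ⟪curl (v t) x, gradient (fun y => ‖v t y‖ ^ 2 / 2) x⟫_ℝ
        + ⟪curl (v t) x, curl (curl (v t)) x⟫_ℝ = 0 := by
  intro t ht x
  have := stub_twistIdentity v q hcl t ht x
  rw [hiso t ht x, add_zero] at this
  exact this

/-! ### The 2½-dimensional Liouville theorem for an arbitrary direction -/

/-- **2½-dimensional Liouville for an arbitrary direction** (from `stub_covariance` and
`stub_fullTranslationLeaf`): a bounded ancient mild solution (`ν = 1`), classical on `(-∞,0)`,
invariant at every `t < 0` under the translations along a fixed `a ≠ 0` is constant on every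
slice. Rotate `a` onto `‖a‖ e₁` (`exists_isometry_map_eq`); invariance along `a` becomes
invariance of the conjugated field along `e₁`. -/
theorem sliceConst_of_translationInvariant
    (v : ℝ → (EuclideanSpace ℝ (Fin 3)) → (EuclideanSpace ℝ (Fin 3)))
    (q : ℝ → (EuclideanSpace ℝ (Fin 3)) → ℝ)
    (hanc : IsBoundedAncientMildSolution 1 v) (hcl : IsClassicalNSSolutionOn (Set.Iio 0) 1 0 v q)
    (a : EuclideanSpace ℝ (Fin 3)) (ha : a ≠ 0)
    (hinv : ∀ t < 0, ∀ (x : EuclideanSpace ℝ (Fin 3)) (δ : ℝ), v t (x + δ • a) = v t x) :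
    ∀ t < 0, ∃ b : EuclideanSpace ℝ (Fin 3), v t = fun _ => b := by
  obtain ⟨R, hR⟩ := exists_isometry_map_eq a (EuclideanSpace.single 1 (1 : ℝ)) (by simp)
  obtain ⟨hanc', hcl'⟩ := stub_covariance v q R 0 hanc hcl
  have hne : ‖a‖ ≠ 0 := norm_ne_zero_iff.2 ha
  refine sliceConst_of_conj v R 0 (stub_fullTranslationLeaf _ _ hanc' hcl' fun t ht y δ => ?_)
  -- `R⁻¹ (y + δ e₁) = R⁻¹ y + (δ / ‖a‖) a`
  have he1 : EuclideanSpace.single (1 : Fin 3) δ = (δ * ‖a‖⁻¹) • R a := by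
    rw [hR, smul_smul, mul_assoc, inv_mul_cancel₀ hne, mul_one]
    ext i
    fin_cases i <;> simp
  change R (v t (R.symm (y + EuclideanSpace.single 1 δ) + 0)) = R (v t (R.symm y + 0))
  rw [he1, map_add, map_smul, LinearIsometryEquiv.symm_apply_apply, add_zero, add_zero,
    hinv t ht (R.symm y) (δ * ‖a‖⁻¹)]

/-! ### The hull is exactly crux-sized -/

/-- **Hull rigidity implies the crux.** If every isobaric bounded ancient mild solution
(classical on `(-∞,0)`) satisfying the persistence identity, the twist identity and the Newcomb
integrals on closed vortex lines lies in one of the three symmetric hulls — (A) vorticity along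
one fixed vector at all `t < 0`, (B) velocity invariant under the translations along one fixed
direction at all `t < 0`, (C) infinitesimally axisymmetric without swirl about one fixed axis at
all `t < 0` — then `IsobaricLinesLiouville` holds: the three extra hypotheses are theorems on
the class (`persistence_identity`, `twist_identity_isobaric`, `stub_newcombClosedLine`) and each
hull is slice-wise constant (`sliceConst_of_curl_parallel`, `sliceConst_of_translationInvariant`,
`sliceConst_of_axisym`; KNSS Thms 5.1–5.2 behind them). This is the composition of line
`Ideator2Sketch` with its one open stub as hypothesis. -/
theorem isobaricLinesLiouville_of_hull :
    (∀ (v : ℝ → (EuclideanSpace ℝ (Fin 3)) → (EuclideanSpace ℝ (Fin 3)))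
      (q : ℝ → (EuclideanSpace ℝ (Fin 3)) → ℝ),
      IsBoundedAncientMildSolution 1 v → IsClassicalNSSolutionOn (Set.Iio 0) 1 0 v q →
      (∀ t < 0, ∀ x : EuclideanSpace ℝ (Fin 3), ⟪curl (v t) x, gradient (q t) x⟫_ℝ = 0) →
      (∀ t < 0, ∀ x : EuclideanSpace ℝ (Fin 3),
        ⟪curl (v t) x,
            gradient (fun y => timeDerivWithin (Set.Iio 0) q t y + ⟪v t y, gradient (q t) y⟫_ℝ) x⟫_ℝ
          = - ⟪(Δ (curl (v t))) x, gradient (q t) x⟫_ℝ) →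
      (∀ t < 0, ∀ x : EuclideanSpace ℝ (Fin 3),
        ⟪curl (v t) x, timeDerivWithin (Set.Iio 0) v t x⟫_ℝ
          + ⟪curl (v t) x, gradient (fun y => ‖v t y‖ ^ 2 / 2) x⟫_ℝ
          + ⟪curl (v t) x, curl (curl (v t)) x⟫_ℝ = 0) →
      (∀ t < 0, ∀ (γ : ℝ → EuclideanSpace ℝ (Fin 3)) (T : ℝ), 0 < T →
        (∀ s, HasDerivAt γ (curl (v t) (γ s)) s) → Function.Periodic γ T →
          ∫ s in (0 : ℝ)..T, ⟪(Δ (curl (v t))) (γ s), gradient (q t) (γ s)⟫_ℝ = 0) →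
      (∃ a : EuclideanSpace ℝ (Fin 3), ∀ t < 0, ∀ x : EuclideanSpace ℝ (Fin 3),
          ∃ μ : ℝ, curl (v t) x = μ • a) ∨
      (∃ a : EuclideanSpace ℝ (Fin 3), a ≠ 0 ∧ ∀ t < 0, ∀ (x : EuclideanSpace ℝ (Fin 3)) (δ : ℝ),
          v t (x + δ • a) = v t x) ∨
      (∃ e c : EuclideanSpace ℝ (Fin 3), e ≠ 0 ∧ ∀ t < 0, ∀ x : EuclideanSpace ℝ (Fin 3),
          fderiv ℝ (v t) x (cross e (x - c)) = cross e (v t x) ∧ ⟪v t x, cross e (x - c)⟫_ℝ = 0)) →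
    IsobaricLinesLiouville := by
  intro hull v q hanc hcl hiso
  have hP := persistence_identity v q hcl hiso
  have hT := twist_identity_isobaric v q hcl hiso
  have hN := stub_newcombClosedLine v q hcl hP
  rcases hull v q hanc hcl hiso hP hT hN with ⟨a, h⟩ | ⟨a, ha, h⟩ | ⟨e, c, he, h⟩
  · exact sliceConst_of_curl_parallel v q hanc hcl a h
  · exact sliceConst_of_translationInvariant v q hanc hcl a ha h
  · exact sliceConst_of_axisym v q hanc hcl e c he (fun t ht x => (h t ht x).1)
      (fun t ht x => (h t ht x).2)

/-- **The crux implies hull rigidity** (so the open stub of line `Ideator2Sketch` is EQUIVALENT to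
the crux, not a weakening of it): if every isobaric bounded ancient mild solution is slice-wise
constant, then its vorticity vanishes identically (`curl_const_eq_zero`), which is hull (A) with
`a = 0` (and `μ = 0`); the persistence / twist / Newcomb hypotheses are not even used. -/
theorem hullRigidity_of_isobaricLinesLiouville :
    IsobaricLinesLiouville → ∀ (v : ℝ → (EuclideanSpace ℝ (Fin 3)) → (EuclideanSpace ℝ (Fin 3)))
      (q : ℝ → (EuclideanSpace ℝ (Fin 3)) → ℝ),
      IsBoundedAncientMildSolution 1 v → IsClassicalNSSolutionOn (Set.Iio 0) 1 0 v q →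
      (∀ t < 0, ∀ x : EuclideanSpace ℝ (Fin 3), ⟪curl (v t) x, gradient (q t) x⟫_ℝ = 0) →
      (∀ t < 0, ∀ x : EuclideanSpace ℝ (Fin 3),
        ⟪curl (v t) x,
            gradient (fun y => timeDerivWithin (Set.Iio 0) q t y + ⟪v t y, gradient (q t) y⟫_ℝ) x⟫_ℝ
          = - ⟪(Δ (curl (v t))) x, gradient (q t) x⟫_ℝ) →
      (∀ t < 0, ∀ x : EuclideanSpace ℝ (Fin 3),
        ⟪curl (v t) x, timeDerivWithin (Set.Iio 0) v t x⟫_ℝ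
          + ⟪curl (v t) x, gradient (fun y => ‖v t y‖ ^ 2 / 2) x⟫_ℝ
          + ⟪curl (v t) x, curl (curl (v t)) x⟫_ℝ = 0) →
      (∀ t < 0, ∀ (γ : ℝ → EuclideanSpace ℝ (Fin 3)) (T : ℝ), 0 < T →
        (∀ s, HasDerivAt γ (curl (v t) (γ s)) s) → Function.Periodic γ T →
          ∫ s in (0 : ℝ)..T, ⟪(Δ (curl (v t))) (γ s), gradient (q t) (γ s)⟫_ℝ = 0) →
      (∃ a : EuclideanSpace ℝ (Fin 3), ∀ t < 0, ∀ x : EuclideanSpace ℝ (Fin 3),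
          ∃ μ : ℝ, curl (v t) x = μ • a) ∨
      (∃ a : EuclideanSpace ℝ (Fin 3), a ≠ 0 ∧ ∀ t < 0, ∀ (x : EuclideanSpace ℝ (Fin 3)) (δ : ℝ),
          v t (x + δ • a) = v t x) ∨
      (∃ e c : EuclideanSpace ℝ (Fin 3), e ≠ 0 ∧ ∀ t < 0, ∀ x : EuclideanSpace ℝ (Fin 3),
          fderiv ℝ (v t) x (cross e (x - c)) = cross e (v t x) ∧ ⟪v t x, cross e (x - c)⟫_ℝ = 0) := by
  intro hL v q hanc hcl hiso _ _ _
  left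
  refine ⟨0, fun t ht x => ⟨0, ?_⟩⟩
  obtain ⟨b, hb⟩ := hL v q hanc hcl hiso t ht
  rw [hb, curl_const_eq_zero, zero_smul]

end Summit.NavierStokesRegularity.NavierStokesRegularity.Theorems.IsobaricLinesLiouville.FluxSurfacePersistence

end
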